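import Mathlib.Analysis.Calculus.FDeriv.Mul
import Mathlib.Analysis.Calculus.Deriv.Comp
import Mathlib.Analysis.Calculus.Deriv.Mul
import Mathlib.Analysis.Calculus.MeanValue
import Mathlib.Analysis.Calculus.ContDiff.Basic
import Mathlib.Analysis.SpecialFunctions.Pow.Deriv
import Mathlib.Analysis.SpecialFunctions.Pow.Asymptotics
import HarnessLib

/-!
# Euler's identity for homogeneous functions and the rigidity of homogeneous `C¹` maps at the
# origin

Topic `Literature/Analysis/Calculus` (namespace `Literature.Analysis.Calculus`); theorems only
(no definitions, no named facts, no `sorry`).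

Hörmander, *The Analysis of Linear Partial Differential Operators I*, §3.2: a function `u` on
`ℝⁿ ∖ 0` is homogeneous of degree `a` if `u(tx) = t^a u(x)` for `t > 0` ((3.2.18)); "If we
differentiate with respect to `t` … and put `t = 1` it follows that" `λu = au` with the radial
vector field `λ = Σ xⱼ∂ⱼ` ((3.2.19)′, "Euler's identity for homogeneous functions"); conversely the
identity integrates back to (3.2.18) along rays.  For maps `U : E → F` between real normed spaces
that are differentiable on ALL of `E` (origin included) the degree is rigid: `a < 0` or
`0 < a < 1` force `U ≡ 0`, `a = 0` forces `U` constant, `a = 1` forces `U` linear (`U = DU(0)`).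
These elementary consequences classify the "linearly degenerate" branch of two-clock collapse
ans\"atze of the ns-blowup census (`FluidComputer/TwoClockCollapseNormalForm.lean`, relation
`p₁U + p₂ DU·y = 0` at `ν = 0`), whose degree-`−1` instance is the tree's
`eq_zero_of_scalingGenerator_eq_zero` (`FluidComputer/ModulatedCollapseGaugeRigidity.lean`).

* `homogeneous_of_fderiv_apply_self` — Euler's identity `DU(y) y = a U(y)` (all `y`) for a
  differentiable `U` integrates to `U(t y) = t^a U(y)`, `t > 0`
  (`s ↦ e^{−as} U(e^s y)` has zero derivative);
* `fderiv_apply_self_of_rpow_homogeneous` — the converse (differentiate `t ↦ U(ty)` at `t = 1`;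
  the integer-degree pointwise version is the tree's
  `Literature.Analysis.FluidPDE.fderiv_apply_self_of_homogeneous`, `NormalisedPressureFarFieldLimit.lean`);
* `apply_zero_eq_zero_of_fderiv_apply_self` (`a ≠ 0 ⇒ U(0) = 0`),
  `eq_zero_of_fderiv_apply_self_of_neg` (`a < 0 ⇒ U = 0`, continuity at `0`),
  `eq_const_of_fderiv_apply_self_of_zero` (`a = 0 ⇒ U = U(0)`),
  `eq_zero_of_fderiv_apply_self_of_lt_one` (`0 < a < 1`, `U ∈ C¹` ⇒ `U = 0`: `DU(ty)y =
  a t^{a−1} U(y)` is unbounded as `t ↓ 0`),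
  `eq_fderiv_zero_of_fderiv_apply_self_of_one` (`a = 1`, `U ∈ C¹` ⇒ `U y = DU(0) y`).

## Mathlib search

Mathlib has homogeneity of norms/seminorms and `Polynomial.IsHomogeneous`, but no Euler identity
for differentiable maps (`rg "Euler" Mathlib/Analysis/Calculus` — nothing relevant, 2026-08-27).
Tools: `is_const_of_deriv_eq_zero`, `HasFDerivAt.comp_hasDerivAt`, `Real.hasDerivAt_exp`,
`Real.rpow_def_of_pos`, `Real.hasDerivAt_rpow_const`, `tendsto_rpow_neg_nhdsGT`-type limits done
by hand with `Real.rpow_lt_rpow_of_exponent_gt`-free elementary estimates.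

## References

* L. Hörmander, *The Analysis of Linear Partial Differential Operators I*, 2nd ed., Springer
  (Classics in Mathematics, 2003), §3.2, Def. 3.2.2, eqs. (3.2.18), (3.2.19), (3.2.19)′.
  [HormanderALPDO1]
-/

noncomputable section

open Set Filter Topology

namespace Literature.Analysis.Calculus

variable {E : Type*} [NormedAddCommGroup E] [NormedSpace ℝ E]
variable {F : Type*} [NormedAddCommGroup F] [NormedSpace ℝ F]

/-! ## Euler's identity ⇔ homogeneity -/

/-- **Euler's identity integrates to homogeneity** (Hörmander (3.2.19)′ ⇒ (3.2.18), for maps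
differentiable on all of `E`): if `DU(y) y = a • U(y)` for every `y`, then `U(t • y) = t^a • U(y)`
for all `y` and `t > 0`. Proof: `ψ(s) = e^{−as} • U(e^s • y)` has derivative
`e^{−as}(−a U + DU(e^s y)(e^s y)) = 0`, so `ψ(s) = ψ(0) = U(y)`; put `t = e^s`.
[cite: HormanderALPDO1, §3.2 eqs. (3.2.18)–(3.2.19)′] -/
theorem homogeneous_of_fderiv_apply_self {U : E → F} {a : ℝ} (hU : Differentiable ℝ U)
    (h : ∀ y, fderiv ℝ U y y = a • U y) (y : E) {t : ℝ} (ht : 0 < t) :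
    U (t • y) = t ^ a • U y := by
  -- the conjugated ray function
  set ψ : ℝ → F := fun s => Real.exp (-a * s) • U (Real.exp s • y) with hψ_def
  have hψ : ∀ s : ℝ, HasDerivAt ψ (0 : F) s := by
    intro s
    have h1 : HasDerivAt (fun s : ℝ => Real.exp (-a * s)) (Real.exp (-a * s) * (-a)) s :=
      (((hasDerivAt_id' s).const_mul (-a)).exp).congr_deriv (by ring)
    have h2 : HasDerivAt (fun s : ℝ => Real.exp s • y) (Real.exp s • y) s :=
      (Real.hasDerivAt_exp s).smul_const y
    have h3 : HasDerivAt (fun s : ℝ => U (Real.exp s • y))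
        (fderiv ℝ U (Real.exp s • y) (Real.exp s • y)) s :=
      (hU (Real.exp s • y)).hasFDerivAt.comp_hasDerivAt s h2
    have h4 := h1.smul h3
    refine h4.congr_deriv ?_
    rw [h (Real.exp s • y), smul_smul]
    -- `e^{-as} • (a • U) + (e^{-as} · (−a)) • U = 0`
    rw [show Real.exp (-a * s) * -a = -(Real.exp (-a * s) * a) by ring, neg_smul, add_neg_cancel]
  have hconst := is_const_of_deriv_eq_zero (fun s => (hψ s).differentiableAt)
    (fun s => (hψ s).deriv) (Real.log t) 0
  simp only [hψ_def, Real.exp_zero, one_smul, mul_zero, Real.exp_log ht] at hconst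
  -- `e^{-a log t} • U(t • y) = U y`
  have hexp : Real.exp (-a * Real.log t) = (t ^ a)⁻¹ := by
    rw [Real.rpow_def_of_pos ht, ← Real.exp_neg]
    ring_nf
  rw [hexp] at hconst
  have hta : (0 : ℝ) < t ^ a := Real.rpow_pos_of_pos ht a
  calc U (t • y) = t ^ a • ((t ^ a)⁻¹ • U (t • y)) := by
        rw [smul_smul, mul_inv_cancel₀ hta.ne', one_smul]
    _ = t ^ a • U y := by rw [hconst]

/-- **Homogeneity implies Euler's identity** (Hörmander (3.2.18) ⇒ (3.2.19)′: "If we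
differentiate with respect to `t` … and put `t = 1`"): if `U` is differentiable and
`U(t • y) = t^a • U(y)` for all `t > 0` (real degree `a`), then `DU(y) y = a • U(y)` (integer
degree, pointwise differentiability: `Literature.Analysis.FluidPDE.fderiv_apply_self_of_homogeneous`).
[cite: HormanderALPDO1, §3.2 eqs. (3.2.18)–(3.2.19)′] -/
theorem fderiv_apply_self_of_rpow_homogeneous {U : E → F} {a : ℝ} (hU : Differentiable ℝ U)
    (h : ∀ y, ∀ t : ℝ, 0 < t → U (t • y) = t ^ a • U y) (y : E) :
    fderiv ℝ U y y = a • U y := by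
  -- differentiate `t ↦ U (t • y)` at `t = 1` in two ways
  have h1 : HasDerivAt (fun t : ℝ => U (t • y)) (fderiv ℝ U ((1 : ℝ) • y) ((1 : ℝ) • y)) 1 :=
    (hU ((1 : ℝ) • y)).hasFDerivAt.comp_hasDerivAt 1 ((hasDerivAt_id (1 : ℝ)).smul_const y)
  rw [one_smul] at h1
  have h2 : HasDerivAt (fun t : ℝ => t ^ a • U y) ((a * (1 : ℝ) ^ (a - 1)) • U y) 1 :=
    (Real.hasDerivAt_rpow_const (Or.inl one_ne_zero)).smul_const (U y)
  rw [Real.one_rpow, mul_one] at h2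
  -- the two functions agree near `t = 1`
  have heq : (fun t : ℝ => U (t • y)) =ᶠ[𝓝 1] fun t : ℝ => t ^ a • U y := by
    filter_upwards [Ioi_mem_nhds (zero_lt_one' ℝ)] with t ht using h y t ht
  exact h1.unique (h2.congr_of_eventuallyEq heq)

/-! ## Rigidity at the origin -/

/-- `a ≠ 0 ⇒ U(0) = 0` (Euler's identity at `y = 0` reads `0 = a • U(0)`).
[cite: HormanderALPDO1, §3.2 eq. (3.2.19)′ (consequence at the origin)] -/
theorem apply_zero_eq_zero_of_fderiv_apply_self {U : E → F} {a : ℝ} (ha : a ≠ 0)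
    (h : ∀ y, fderiv ℝ U y y = a • U y) : U 0 = 0 := by
  have h0 := h 0
  rw [map_zero] at h0
  exact (smul_eq_zero.mp h0.symm).resolve_left ha

/-- **Negative degree: `U ≡ 0`.** A map differentiable on all of `E` with `DU(y) y = a • U(y)`,
`a < 0`, vanishes identically: `‖U(t y)‖ = t^a ‖U(y)‖` would blow up as `t ↓ 0` while
`U(t y) → U(0)`. (On `E ∖ {0}` this fails: `|y|^a`-type profiles.)
[cite: HormanderALPDO1, §3.2 eqs. (3.2.18)–(3.2.19)′ (consequence at the origin)] -/
theorem eq_zero_of_fderiv_apply_self_of_neg {U : E → F} {a : ℝ} (hU : Differentiable ℝ U)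
    (ha : a < 0) (h : ∀ y, fderiv ℝ U y y = a • U y) : U = 0 := by
  funext y
  by_contra hy
  have hUy : 0 < ‖U y‖ := norm_pos_iff.mpr hy
  -- continuity at `0` along the ray `t ↦ t • y`, `t ↓ 0`
  have hcont : Tendsto (fun t : ℝ => U (t • y)) (𝓝[>] 0) (𝓝 (U 0)) := by
    have h1 : Tendsto (fun t : ℝ => t • y) (𝓝 0) (𝓝 ((0 : ℝ) • y)) :=
      (continuous_id.smul continuous_const).tendsto 0
    rw [zero_smul] at h1
    exact ((hU.continuous.tendsto 0).comp h1).mono_left nhdsWithin_le_nhds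
  have hbdd : ∀ᶠ t : ℝ in 𝓝[>] 0, ‖U (t • y)‖ < ‖U 0‖ + 1 := by
    have := hcont.norm
    exact this.eventually (gt_mem_nhds (by linarith [norm_nonneg (U 0)]))
  -- but `‖U (t • y)‖ = t^a ‖U y‖ → ∞`
  have hblow : ∀ᶠ t : ℝ in 𝓝[>] 0, ‖U 0‖ + 1 < ‖U (t • y)‖ := by
    have hlim : Tendsto (fun t : ℝ => t ^ a * ‖U y‖) (𝓝[>] 0) atTop :=
      (tendsto_rpow_neg_nhdsGT_zero ha).atTop_mul_const hUy
    filter_upwards [hlim.eventually (eventually_gt_atTop (‖U 0‖ + 1)), self_mem_nhdsWithin]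
      with t ht ht0
    rw [homogeneous_of_fderiv_apply_self hU h y ht0, norm_smul,
      Real.norm_of_nonneg (Real.rpow_nonneg (le_of_lt ht0) a)]
    exact ht
  obtain ⟨t, h1, h2⟩ := (hbdd.and hblow).exists
  linarith

/-- **Degree zero: `U` is constant.** A map differentiable on all of `E` with `DU(y) y = 0` for
all `y` is constant, `U(y) = U(0)` (`U(t y) = U(y)` for `t > 0` and `U(t y) → U(0)` as `t ↓ 0`).
[cite: HormanderALPDO1, §3.2 eqs. (3.2.18)–(3.2.19)′ (consequence at the origin)] -/
theorem eq_const_of_fderiv_apply_self_of_zero {U : E → F} (hU : Differentiable ℝ U)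
    (h : ∀ y, fderiv ℝ U y y = 0) (y : E) : U y = U 0 := by
  have h' : ∀ y, fderiv ℝ U y y = (0 : ℝ) • U y := fun y => by rw [h y, zero_smul]
  have hcont : Tendsto (fun t : ℝ => U (t • y)) (𝓝[>] 0) (𝓝 (U 0)) := by
    have h1 : Tendsto (fun t : ℝ => t • y) (𝓝 0) (𝓝 ((0 : ℝ) • y)) :=
      (continuous_id.smul continuous_const).tendsto 0
    rw [zero_smul] at h1
    exact ((hU.continuous.tendsto 0).comp h1).mono_left nhdsWithin_le_nhds
  have heq : (fun t : ℝ => U (t • y)) =ᶠ[𝓝[>] 0] fun _ => U y := by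
    filter_upwards [self_mem_nhdsWithin] with t ht
    rw [homogeneous_of_fderiv_apply_self hU h' y ht, Real.rpow_zero, one_smul]
  have hlim : Tendsto (fun _ : ℝ => U y) (𝓝[>] (0 : ℝ)) (𝓝 (U 0)) := hcont.congr' heq
  exact tendsto_nhds_unique tendsto_const_nhds hlim

/-- **Degree in `(0, 1)`: `U ≡ 0` for `C¹` maps.** If `U ∈ C¹(E; F)` and `DU(y) y = a • U(y)`
with `0 < a < 1`, then `U ≡ 0`: Euler's identity at `t • y` gives `DU(t y) y = a t^{a−1} • U(y)`,
whose norm blows up as `t ↓ 0` unless `U(y) = 0`, while `DU(t y) → DU(0)`.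
[cite: HormanderALPDO1, §3.2 eqs. (3.2.18)–(3.2.19)′ (consequence at the origin)] -/
theorem eq_zero_of_fderiv_apply_self_of_lt_one {U : E → F} {a : ℝ} (hU : ContDiff ℝ 1 U)
    (ha0 : 0 < a) (ha1 : a < 1) (h : ∀ y, fderiv ℝ U y y = a • U y) : U = 0 := by
  have hUd : Differentiable ℝ U := hU.differentiable one_ne_zero
  funext y
  by_contra hy
  have hUy : 0 < ‖U y‖ := norm_pos_iff.mpr hy
  -- `DU(t y) y = a t^{a-1} • U y` for `t > 0`
  have hray : ∀ t : ℝ, 0 < t → fderiv ℝ U (t • y) y = (a * t ^ (a - 1)) • U y := by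
    intro t ht
    have h1 := h (t • y)
    rw [map_smul, homogeneous_of_fderiv_apply_self hUd h y ht, smul_smul] at h1
    -- `t • DU(ty) y = (a t^a) • U y`
    have h2 : fderiv ℝ U (t • y) y = t⁻¹ • ((a * t ^ a) • U y) := by
      rw [← h1, smul_smul, inv_mul_cancel₀ ht.ne', one_smul]
    rw [h2, smul_smul]
    congr 1
    rw [Real.rpow_sub_one ht.ne']
    field_simp
  -- continuity of `DU` at `0` along the ray
  have hDc : Continuous (fderiv ℝ U) := hU.continuous_fderiv one_ne_zero
  have hcont : Tendsto (fun t : ℝ => fderiv ℝ U (t • y) y) (𝓝[>] 0) (𝓝 (fderiv ℝ U 0 y)) := by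
    have h1 : Tendsto (fun t : ℝ => t • y) (𝓝 0) (𝓝 ((0 : ℝ) • y)) :=
      (continuous_id.smul continuous_const).tendsto 0
    rw [zero_smul] at h1
    have h2 := ((hDc.tendsto 0).comp h1).mono_left (nhdsWithin_le_nhds (s := Ioi (0 : ℝ)))
    exact (ContinuousLinearMap.apply ℝ F y).continuous.continuousAt.tendsto.comp h2
  have hbdd : ∀ᶠ t : ℝ in 𝓝[>] 0, ‖fderiv ℝ U (t • y) y‖ < ‖fderiv ℝ U 0 y‖ + 1 :=
    hcont.norm.eventually (gt_mem_nhds (by linarith [norm_nonneg (fderiv ℝ U 0 y)]))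
  have hblow : ∀ᶠ t : ℝ in 𝓝[>] 0, ‖fderiv ℝ U 0 y‖ + 1 < ‖fderiv ℝ U (t • y) y‖ := by
    have ha' : a - 1 < 0 := by linarith
    have hlim : Tendsto (fun t : ℝ => t ^ (a - 1) * (a * ‖U y‖)) (𝓝[>] 0) atTop :=
      (tendsto_rpow_neg_nhdsGT_zero ha').atTop_mul_const (by positivity)
    filter_upwards [hlim.eventually (eventually_gt_atTop (‖fderiv ℝ U 0 y‖ + 1)),
      self_mem_nhdsWithin] with t ht ht0
    rw [hray t ht0, norm_smul,
      Real.norm_of_nonneg (mul_nonneg ha0.le (Real.rpow_nonneg (le_of_lt ht0) _))]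
    calc ‖fderiv ℝ U 0 y‖ + 1 < t ^ (a - 1) * (a * ‖U y‖) := ht
      _ = a * t ^ (a - 1) * ‖U y‖ := by ring
  obtain ⟨t, h1, h2⟩ := (hbdd.and hblow).exists
  linarith

/-- **Degree one: `U` is linear, `U = DU(0)`, for `C¹` maps.** If `U ∈ C¹(E; F)` and
`DU(y) y = U(y)` for all `y`, then `U y = DU(0) y`: along the ray, `DU(t y) y = U(y)` for every
`t > 0`, and `DU(t y) → DU(0)` as `t ↓ 0`.
[cite: HormanderALPDO1, §3.2 eqs. (3.2.18)–(3.2.19)′ (consequence at the origin)] -/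
theorem eq_fderiv_zero_of_fderiv_apply_self_of_one {U : E → F} (hU : ContDiff ℝ 1 U)
    (h : ∀ y, fderiv ℝ U y y = U y) (y : E) : U y = fderiv ℝ U 0 y := by
  have hUd : Differentiable ℝ U := hU.differentiable one_ne_zero
  have h' : ∀ y, fderiv ℝ U y y = (1 : ℝ) • U y := fun y => by rw [h y, one_smul]
  have hray : ∀ t : ℝ, 0 < t → fderiv ℝ U (t • y) y = U y := by
    intro t ht
    have h1 := h (t • y)
    rw [map_smul, homogeneous_of_fderiv_apply_self hUd h' y ht, Real.rpow_one] at h1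
    exact smul_right_injective F ht.ne' h1
  have hDc : Continuous (fderiv ℝ U) := hU.continuous_fderiv one_ne_zero
  have hcont : Tendsto (fun t : ℝ => fderiv ℝ U (t • y) y) (𝓝[>] 0) (𝓝 (fderiv ℝ U 0 y)) := by
    have h1 : Tendsto (fun t : ℝ => t • y) (𝓝 0) (𝓝 ((0 : ℝ) • y)) :=
      (continuous_id.smul continuous_const).tendsto 0
    rw [zero_smul] at h1
    have h2 := ((hDc.tendsto 0).comp h1).mono_left (nhdsWithin_le_nhds (s := Ioi (0 : ℝ)))
    exact (ContinuousLinearMap.apply ℝ F y).continuous.continuousAt.tendsto.comp h2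
  have heq : (fun t : ℝ => fderiv ℝ U (t • y) y) =ᶠ[𝓝[>] 0] fun _ => U y := by
    filter_upwards [self_mem_nhdsWithin] with t ht using hray t ht
  exact tendsto_nhds_unique tendsto_const_nhds (hcont.congr' heq)

end Literature.Analysis.Calculus

end
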